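/- Copyright: the b2b-balaban cell (near-miss cell 7), T⁴-continuum fan-out; row NE7b OWNER lineage t4-ne7b-p1 (gen 48) —
RULING R-OWNER-48-2 (3) ∕ referee OI-73: the rounding window's coupling clause IS the headline's own quantifier prefix
(`CLAIMS.log` l.32557).  Released under the licence of the surrounding project. -/
import Summits.QuantumFields.BalabanUV.T4Continuum.Support.HistoryBankingRoundingUnrounded
import Literature.MathematicalPhysics.QuantumFieldTheory.Balaban1983to89.T4ContinuumYM4Torus

/-!
# History banking, M5-3 (γ′): THE ROUNDING WINDOW IS SUPPLIED BY THE TUNED PREFIX (owner, R-OWNER-48-2 (3); referee OI-73)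

Summits-side support leaf of the T⁴-continuum cell (rung (B)+1 on a FINITE torus only; NOT infinite volume, NOT the
mass gap, NOT the Clay statement; NOT a proof of the spine estimate NE7b — the cell's OWN estimate, NOT PRINTED, NOT
PROVED).  [folklore] composition by name over leaf-06's «ROUNDING WINDOW» file 4
`HistoryBankingRoundingUnrounded.roundingRoomF_unrounded_of_couplings` (p281389) and the Literature prefix
`T4ContinuumYM4Torus.ForSmallCouplings` ∕ `T4Continuum.FiniteEpsData.Tuned` ∕ `Setup.Flow.InInterval`; four theorems, no
definition, no `[cite:]` tag, nothing printed asserted, zero `sorry`.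

WHY.  After leaf-06's files 1–4 the WALL's display `RoundingRoomF C O L K R g sB sR φB φR` (both runs' letters `hRR`∕`hRR′`
of `HistReadData(L)`) holds at the instantiation of record `(sB ≥ sBsharp, sR := sRunr = S_h)` modulo (2.9), (2.5), the
φ-budgets, census exponent identities — and ONE clause on the RUNNING couplings of the cutoff-`K` run,
`∀ j ≤ K, 0 < g_j ≤ γ ≤ e^{−ℓ⋆∕2}` (referee pass 57 OI-73: «is that window what `ForSmallCouplings` supplies?»).  IT IS, BY
DEFINITION: the headline's prefix `ForSmallCouplings D concl` quantifies over bare-coupling sequences `g₀` TUNED within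
`]0, γ]` (`D.Tuned γ g g₀ := ∀ K, (D.C ⟨K, F.m, g₀ K⟩).flow.InInterval γ K ∧ … = g`, [Balaban1987RG1] Thm 2 p. 259's
renormalisation condition «the sequence of the effective coupling constants g_k is contained in the interval ]0, γ]»), and
`Flow.InInterval γ K` IS `∀ k ≤ K, 0 < g_k ∧ g_k ≤ γ` — the window's clause, letter for letter, for EVERY cutoff `K`, with the
prefix's outer threshold `γ₀` free to be taken `≤ e^{−ℓ⋆∕2}` (`ellStar` is `K`-free).  No monotonicity of the flow is used.

WHAT.  §1 **`roundingRoomF_unrounded_of_inInterval`** — file 4's one-call form with its coupling hypothesis `hg` retyped as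
`Flow.InInterval`; **`roundingRoomF_unrounded_of_tuned`** — the same for the cutoff-`K` run of a datum `D : FiniteEpsData F G`
at a tuned sequence `D.Tuned γ g g₀` (`L := F.L`, `g := (D.C ⟨K, F.m, g₀ K⟩).flow.g` — the letters of `HistReadData.hRR`).
§2 **`forSmallCouplings_inInterval`** — for ANY threshold `γs > 0`, `ForSmallCouplings D (fun g₀ => ∀ K, (D.C ⟨K, F.m, g₀ K⟩).flow.InInterval γs K)`
(outer threshold `γ₀ := γs`, inner `g₁ := 1`; `InInterval` is monotone in `γ`); **`forSmallCouplings_roundingRoomF`** — hence,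
under the headline's OWN prefix, `RoundingRoomF` at the instantiation of record holds for every cutoff whose side letters
((2.9), (2.5), `1 ≤ R`, φ-budgets, `sB ≥ sBsharp`) are supplied — the form a later `HistReadData` twin WITHOUT `hRR`∕`hRR′`
consumes through `ForSmallCouplings.and` + `.mono`.

BY-NAME EFFECT (`WALL-NE7b-P1.md` v1.22 §2 row `RoundingRoomF`): the coupling window is NOT a residual hypothesis of the row —
it is the (B)+1 headline's quantifier prefix; what `RoundingRoomF` still costs is (2.9)∕(2.5) (NE7's rate rows), the φ-budgets
and `sB ≥ sBsharp` (free letters, C-side), the t = d+3 exponent identities and sign∕size letters (census), `A₁² ≤ m`.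
HONEST: NE7b NOT proved; spine 0∕9.  HONEST DEPENDENCY (cell): continuum YM on T⁴ ⇐ BetaPertH ∧ nine spine estimates (0/9
proved); BetaPertH ⇐ (D1) ∧ (D4) ∧ CAP+tail; G-an2-4 gates asym, D1 and NE2/3/4.  Unchanged here. -/

open Finset
open Literature.MathematicalPhysics.QuantumFieldTheory.Balaban1983to89
open T4PersistenceDictionary T4PrintedShapeBanking T4Continuum T4ContinuumYM4Torus
open Summit.QuantumFields.BalabanUV.T4Continuum.HistoryConstants
open Summit.QuantumFields.BalabanUV.T4Continuum.HistoryBankingDiscountCharge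
open Summit.QuantumFields.BalabanUV.T4Continuum.HistoryBankingFibreRoom
open Summit.QuantumFields.BalabanUV.T4Continuum.HistoryBankingSharpShares
open Summit.QuantumFields.BalabanUV.T4Continuum.HistoryBankingRoundingWindow
open Summit.QuantumFields.BalabanUV.T4Continuum.HistoryBankingRoundingSupply
open Summit.QuantumFields.BalabanUV.T4Continuum.HistoryBankingRoundingUnrounded

namespace Summit.QuantumFields.BalabanUV.T4Continuum.HistoryBankingRoundingTuned

noncomputable section

/-! ## §1 The window's coupling clause in the letters `Flow.InInterval` ∕ `FiniteEpsData.Tuned` -/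

section Interval

variable {C : T4PrintedShapeBanking.Consts} {O : PrintedO1s} {L K r p₁ η η' κ : ℕ} {Φ m Lr : ℝ} {R : ℕ → ℕ}
  {β' β₀ : ℝ} {φB : ℕ → ℕ → ℝ} {φR : ℕ → ℝ} {sB : ℕ → ℕ → ℝ}

/-- **`RoundingRoomF` AT THE INSTANTIATION OF RECORD FROM `Flow.InInterval`**: leaf-06's
`roundingRoomF_unrounded_of_couplings` with its coupling hypothesis `∀ j ≤ K, 0 < g_j ∧ g_j ≤ γ` supplied by
`Fl.InInterval γ K` — the SAME clause by `Setup.Flow.InInterval`'s definition. [folklore] -/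
theorem roundingRoomF_unrounded_of_inInterval (Fl : Flow) {γ : ℝ} (hI : Fl.InInterval γ K)
    (hexpR : C.p₀ + r * (O.d + 3) + η = 2 * p₁)
    (hexpR' : r * (C.q' + 1) + r * (O.d + 3) + η' = 2 * p₁) (hexpB : r * (C.q' + 1) + κ = 2 * C.p₀)
    (hη : 1 ≤ η) (hη' : 1 ≤ η') (hκ : 1 ≤ κ) (hp₀ : 1 ≤ C.p₀) (hAp : ApFlat O.γ₀ O.A₁ O.M Lr O.d ≠ 0)
    (hγ₀ : 0 < O.γ₀) (hA₁ : O.A₁ ≠ 0) (hA₀ : 0 < C.A₀) (hM : 0 < O.M) (hLr : 0 ≤ Lr)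
    (hβd : O.β₀ * ((O.d : ℝ) + 2) ≤ 1) (hΦ : 0 ≤ Φ) (hE₂ : 0 < C.E₂) (hE₃ : 0 ≤ C.E₃) (hL : 1 ≤ L)
    (hm : O.A₁ ^ 2 ≤ m) (h29 : B14FlowStep.FlowIneq29 R Fl.g L β' β₀ K)
    (hRj : ∀ j, j ≤ K → B14.IsRj L r (Fl.g j) (R j)) (hR1 : ∀ h, 1 ≤ R h)
    (hγ : γ ≤ Real.exp (-(ellStar C O L (O.d + 3) η η' κ (ApFlat O.γ₀ O.A₁ O.M Lr O.d) Φ / 2)))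
    (hφB : ∀ j d', φB j d' ≤ Φ * dshare C L R ((j, 0, d') : PEv))
    (hφR : ∀ h, φR h ≤ Φ * dshare C L R ((h + 1, 1, 0) : PEv)) (hsB : ∀ j d', sBsharp O m C Fl.g j d' ≤ sB j d') :
    RoundingRoomF C O L K R Fl.g sB (sRunr O.γ₀ O.A₁ O.M Lr O.β₀ O.d p₁ R Fl.g) φB φR :=
  roundingRoomF_unrounded_of_couplings hexpR hexpR' hexpB hη hη' hκ hp₀ hAp hγ₀ hA₁ hA₀ hM hLr hβd hΦ hE₂ hE₃ hL hm h29
    hRj hR1 hγ (fun j hj => hI j hj) hφB hφR hsB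

variable {F : T4Family} {G : Type*} [GaugeGroup G] [MeasurableSpace G] [HaarData G]

/-- **… FOR THE CUTOFF-`K` RUN OF A DATUM AT A TUNED SEQUENCE** (the letters of `HistReadData.hRR`: `L := F.L`,
`g := (D.C ⟨K, F.m, g₀ K⟩).flow.g`): `D.Tuned γ g g₀` gives `InInterval γ K` for every `K`. [folklore] -/
theorem roundingRoomF_unrounded_of_tuned (D : FiniteEpsData F G) {γ g : ℝ} {g₀ : ℕ → ℝ} (ht : D.Tuned γ g g₀) (K : ℕ)
    (hexpR : C.p₀ + r * (O.d + 3) + η = 2 * p₁)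
    (hexpR' : r * (C.q' + 1) + r * (O.d + 3) + η' = 2 * p₁) (hexpB : r * (C.q' + 1) + κ = 2 * C.p₀)
    (hη : 1 ≤ η) (hη' : 1 ≤ η') (hκ : 1 ≤ κ) (hp₀ : 1 ≤ C.p₀) (hAp : ApFlat O.γ₀ O.A₁ O.M Lr O.d ≠ 0)
    (hγ₀ : 0 < O.γ₀) (hA₁ : O.A₁ ≠ 0) (hA₀ : 0 < C.A₀) (hM : 0 < O.M) (hLr : 0 ≤ Lr)
    (hβd : O.β₀ * ((O.d : ℝ) + 2) ≤ 1) (hΦ : 0 ≤ Φ) (hE₂ : 0 < C.E₂) (hE₃ : 0 ≤ C.E₃) (hL : 1 ≤ F.L)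
    (hm : O.A₁ ^ 2 ≤ m) (h29 : B14FlowStep.FlowIneq29 R (D.C ⟨K, F.m, g₀ K⟩).flow.g F.L β' β₀ K)
    (hRj : ∀ j, j ≤ K → B14.IsRj F.L r ((D.C ⟨K, F.m, g₀ K⟩).flow.g j) (R j)) (hR1 : ∀ h, 1 ≤ R h)
    (hγ : γ ≤ Real.exp (-(ellStar C O F.L (O.d + 3) η η' κ (ApFlat O.γ₀ O.A₁ O.M Lr O.d) Φ / 2)))
    (hφB : ∀ j d', φB j d' ≤ Φ * dshare C F.L R ((j, 0, d') : PEv))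
    (hφR : ∀ h, φR h ≤ Φ * dshare C F.L R ((h + 1, 1, 0) : PEv))
    (hsB : ∀ j d', sBsharp O m C (D.C ⟨K, F.m, g₀ K⟩).flow.g j d' ≤ sB j d') :
    RoundingRoomF C O F.L K R (D.C ⟨K, F.m, g₀ K⟩).flow.g sB
      (sRunr O.γ₀ O.A₁ O.M Lr O.β₀ O.d p₁ R (D.C ⟨K, F.m, g₀ K⟩).flow.g) φB φR :=
  roundingRoomF_unrounded_of_inInterval (D.C ⟨K, F.m, g₀ K⟩).flow (ht K).1 hexpR hexpR' hexpB hη hη' hκ hp₀ hAp hγ₀ hA₁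
    hA₀ hM hLr hβd hΦ hE₂ hE₃ hL hm h29 hRj hR1 hγ hφB hφR hsB

end Interval

/-! ## §2 The window is the headline's own quantifier prefix -/

section Prefix

variable {F : T4Family} {G : Type*} [GaugeGroup G] [MeasurableSpace G] [HaarData G]

/-- **THE TUNED PREFIX SUPPLIES EVERY FIXED WINDOW**: for any threshold `γs > 0`,
`ForSmallCouplings D (fun g₀ => ∀ K, (D.C ⟨K, F.m, g₀ K⟩).flow.InInterval γs K)` — outer threshold `γ₀ := γs`, inner
`g₁ := 1`, and `InInterval γ K → InInterval γs K` for `γ ≤ γs` (the one-line monotonicity of `InInterval` in `γ`,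
`B14Cor3.inInterval_of_le`'s content, inlined). [folklore] -/
theorem forSmallCouplings_inInterval (D : FiniteEpsData F G) {γs : ℝ} (hγs : 0 < γs) :
    ForSmallCouplings D (fun g₀ => ∀ K, (D.C ⟨K, F.m, g₀ K⟩).flow.InInterval γs K) :=
  ⟨γs, hγs, fun _ _ hγle => ⟨1, one_pos, fun _ _ _ _ ht K k hk => ⟨((ht K).1 k hk).1, ((ht K).1 k hk).2.trans hγle⟩⟩⟩

/-- **`RoundingRoomF` UNDER THE HEADLINE's OWN PREFIX** (answers referee OI-73): with the outer threshold taken at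
`e^{−ℓ⋆∕2}` (`ellStar` is `K`-free), for all small-coupling tuned runs and every cutoff `K` whose side letters are supplied
((2.9), (2.5), `1 ≤ R`, the φ-budgets, `sB ≥ sBsharp`; sizes `R K`, letters `sB K`, `φB K`, `φR K` per cutoff as in
`HistReadData.hRR`), `RoundingRoomF` holds at the instantiation of record.  No monotonicity of the flow is used. [folklore] -/
theorem forSmallCouplings_roundingRoomF (D : FiniteEpsData F G) {C : T4PrintedShapeBanking.Consts} {O : PrintedO1s}
    {r p₁ η η' κ : ℕ} {Φ m Lr β' β₀ : ℝ} (R : ℕ → ℕ → ℕ) (sB φB : ℕ → ℕ → ℕ → ℝ) (φR : ℕ → ℕ → ℝ)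
    (hexpR : C.p₀ + r * (O.d + 3) + η = 2 * p₁)
    (hexpR' : r * (C.q' + 1) + r * (O.d + 3) + η' = 2 * p₁) (hexpB : r * (C.q' + 1) + κ = 2 * C.p₀)
    (hη : 1 ≤ η) (hη' : 1 ≤ η') (hκ : 1 ≤ κ) (hp₀ : 1 ≤ C.p₀) (hAp : ApFlat O.γ₀ O.A₁ O.M Lr O.d ≠ 0)
    (hγ₀ : 0 < O.γ₀) (hA₁ : O.A₁ ≠ 0) (hA₀ : 0 < C.A₀) (hM : 0 < O.M) (hLr : 0 ≤ Lr)
    (hβd : O.β₀ * ((O.d : ℝ) + 2) ≤ 1) (hΦ : 0 ≤ Φ) (hE₂ : 0 < C.E₂) (hE₃ : 0 ≤ C.E₃) (hL : 1 ≤ F.L)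
    (hm : O.A₁ ^ 2 ≤ m) :
    ForSmallCouplings D (fun g₀ => ∀ K,
      B14FlowStep.FlowIneq29 (R K) (D.C ⟨K, F.m, g₀ K⟩).flow.g F.L β' β₀ K →
      (∀ j, j ≤ K → B14.IsRj F.L r ((D.C ⟨K, F.m, g₀ K⟩).flow.g j) (R K j)) → (∀ h, 1 ≤ R K h) →
      (∀ j d', φB K j d' ≤ Φ * dshare C F.L (R K) ((j, 0, d') : PEv)) →
      (∀ h, φR K h ≤ Φ * dshare C F.L (R K) ((h + 1, 1, 0) : PEv)) →
      (∀ j d', sBsharp O m C (D.C ⟨K, F.m, g₀ K⟩).flow.g j d' ≤ sB K j d') →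
      RoundingRoomF C O F.L K (R K) (D.C ⟨K, F.m, g₀ K⟩).flow.g (sB K)
        (sRunr O.γ₀ O.A₁ O.M Lr O.β₀ O.d p₁ (R K) (D.C ⟨K, F.m, g₀ K⟩).flow.g) (φB K) (φR K)) := by
  refine (forSmallCouplings_inInterval D (Real.exp_pos
    (-(ellStar C O F.L (O.d + 3) η η' κ (ApFlat O.γ₀ O.A₁ O.M Lr O.d) Φ / 2)))).mono fun g₀ hI K h29 hRj hR1 hφB hφR hsB => ?_
  exact roundingRoomF_unrounded_of_inInterval (D.C ⟨K, F.m, g₀ K⟩).flow (hI K) hexpR hexpR' hexpB hη hη' hκ hp₀ hAp hγ₀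
    hA₁ hA₀ hM hLr hβd hΦ hE₂ hE₃ hL hm h29 hRj hR1 le_rfl hφB hφR hsB

end Prefix

/-! ## §3 (v1.1, owner gen 48 — SPEC D-48-1 «THE PREFIX TWIN» §3 (c), IR-48-3) The one-call junction for record twins

THE D-48-1 CAVEAT.  In the (α) assembly the letters `ℛ.R`, `sB`, `φB`, `φR` are READING DATA bound INSIDE the prefix's
conclusion (they depend on the tuned sequence `g₀`), so `forSmallCouplings_roundingRoomF` (whose letters are bound OUTSIDE)
does not compose with a `HistReadData`-type record; what composes is: strengthen ANY prefixed conclusion `c₁` by the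
fixed window `∀ K, InInterval γs K` and map — the lemma below —, then apply `roundingRoomF_unrounded_of_inInterval` (§1)
and leaf-06's volume-window lemmas INSIDE the map, at the record's own letters. -/

section Junction

variable {F : T4Family} {G : Type*} [GaugeGroup G] [MeasurableSpace G] [HaarData G]

/-- **MONOTONICITY OF THE PREFIX WITH THE WINDOW IN HAND**: to pass from a prefixed conclusion `c₁` to `c₂` one may USE,
besides `c₁ g₀`, the coupling window `∀ K, (D.C ⟨K, F.m, g₀ K⟩).flow.InInterval γs K` for any fixed `γs > 0` (the outer
threshold drops to `min γ₀ γs`).  `= (h.and (forSmallCouplings_inInterval D hγs)).mono …`. [folklore] -/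
theorem forSmallCouplings_mono_inInterval (D : FiniteEpsData F G) {c₁ c₂ : (ℕ → ℝ) → Prop} {γs : ℝ} (hγs : 0 < γs)
    (himp : ∀ g₀, (∀ K, (D.C ⟨K, F.m, g₀ K⟩).flow.InInterval γs K) → c₁ g₀ → c₂ g₀)
    (h : ForSmallCouplings D c₁) : ForSmallCouplings D c₂ :=
  (h.and (forSmallCouplings_inInterval D hγs)).mono fun g₀ hh => himp g₀ hh.2 hh.1

/-- **… WITH TWO WINDOWS** (the rounding window `e^{−ℓ⋆∕2}` and leaf-06's volume window at once): for `γr, γv > 0` the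
map may use `InInterval (min γr γv) K`, hence both `InInterval γr K` and `InInterval γv K`, for every `K`. [folklore] -/
theorem forSmallCouplings_mono_inInterval₂ (D : FiniteEpsData F G) {c₁ c₂ : (ℕ → ℝ) → Prop} {γr γv : ℝ}
    (hγr : 0 < γr) (hγv : 0 < γv)
    (himp : ∀ g₀, (∀ K, (D.C ⟨K, F.m, g₀ K⟩).flow.InInterval γr K) →
      (∀ K, (D.C ⟨K, F.m, g₀ K⟩).flow.InInterval γv K) → c₁ g₀ → c₂ g₀)
    (h : ForSmallCouplings D c₁) : ForSmallCouplings D c₂ :=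
  forSmallCouplings_mono_inInterval D (lt_min hγr hγv)
    (fun g₀ hI hc => himp g₀ (fun K k hk => ⟨(hI K k hk).1, (hI K k hk).2.trans (min_le_left _ _)⟩)
      (fun K k hk => ⟨(hI K k hk).1, (hI K k hk).2.trans (min_le_right _ _)⟩) hc) h

end Junction

end

end Summit.QuantumFields.BalabanUV.T4Continuum.HistoryBankingRoundingTuned
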